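import Summits.QuantumFields.YangMills.Theorems.BalabanUVNodesN11TopPairLocalResidual
import Summits.QuantumFields.YangMills.Theorems.BalabanUVNodesN11Sect3SupplyChainObligationsDefs

/-!
EDITION v1.1 (dag-n11-d g31, 2026-08-29; T0′ of the FLAG №1 R2b cure): the three editions take the DISPLAYED one-scale law `hzh` of the step-1 residuals
instead of the proviso structure (whose row `zhLocal` the cure re-types IN PLACE to print's two-scale law, [III] (3.1)–(3.4) pp.264–267); content unchanged.

# DAG node N11 — THE MAIN TERM AT EVERY PARAMETER WHOSE STEP-1 RESIDUAL IS ONE-SCALE (`hzh`, displayed), CHAIN CURRENCY: dag-n08-w2's `FirstStepClausesAt`, dag-n11-e's `PresentChildObligations 0` and the chain's `ChainFormTAt … 0`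
# each carry the top pair's (O3′) clause as a conjunct, so at every `θ : Stage13HParams F 2` obeying `hzh` (no proviso is read; since W2∕T1′ the row `zhLocal` does NOT imply `hzh`) and the guards each serves the
# top pair `(𝕋, 𝕋)` only with a vanishing 𝐓-slot (count-neutral, LOCATED; editions of `…N11TopPairLocalResidual` for the chain road's consumers)

HEADER — WORK-UNIT METADATA.  Cell `pub-ymgap`, YM-PLAN Track A (HUMAN RULING D-0062), seat `pub-ymgap-dag-n11-d` (g19; N11 [B14], s2), route `BalabanUVNodes`, item K1⁹ =
stmt-QuantumFields-27364 (helper lane, `--kind proof --supports 27364 --as helper`, count-neutral).  [III] = [Balaban1988Convergent], [B7] = [Balaban1985Averaging], [I] = [Balaban1987RG1].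
Over this seat's g19 `…N11TopPairLocalResidual` (★★★★ `main_term_absent_of_O3_of_provisos₁₃SepCoPH_su2` ∕ `…CoPH_su2`, ★★★★★ `tLaw₁₃CoPH_zero_top_pair_degenerate_su2`), dag-n08-w2 ∕
dag-n11-e's `…N11SupplyChainFirstLink.FirstStepClausesAt` (clause (iii)), dag-n11-e's `…N11Sect3SupplyChainDefs.PresentChildObligations` (clause (O3′)) and
`…N11Sect3SupplyChainObligationsDefs.ChainFormTAt` (`tLaw₁₃CoPH_of_chainFormTAt`).

WHY THIS FILE.  The chain road's per-child currencies are the consumers of the top pair's (O3′) clause: `FirstStepClausesAt θ p s′ u₁ e₁` (k = 0, one pair), `PresentChildObligations θ p 0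
t tnew E s′` (k = 0, spliced terms `graftAboveB 0 (t (init s′)) (tnew s′)`), `ChainFormTAt θ p σ 0` (the whole first 𝐓-law for the supplier's spliced witness).  Each contains, at a top
pair `s′ = (𝕋, 𝕋)`, exactly the hypothesis `hO3` of `…N11TopPairLocalResidual` §4 — so at every `θ` whose step-1 residuals obey the displayed one-scale law `hzh`, under the guards, each is met at
the top pair only with `𝐓ρ₀(𝕋,𝕋) ≡ 0` or `= 0` a.e. on `{χ₁ ≠ 0}`: THE MAIN TERM OF [III] THM 1 IS NOT WHAT THESE TOKENS CAN CARRY at such `θ` (NOT a statement about K1⁹'s provisos; census in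
`…N11TopPairLocalResidual`'s header: def-R's unit branch × 11a's base-configuration reading × 12b's `zeta0_local`).

WHAT THIS FILE PROVES (0 `def`, 0 `sorry`, standard axioms).  ★★★★ `firstStepClausesAt_top_pair_degenerate_su2` · ★★★★ `presentChildObligations_zero_top_pair_degenerate_su2` ·
★★★★★ `chainFormTAt_zero_top_pair_degenerate_su2` (all three take `hzh` and the guards only; the supplier's own spliced witness).

HONEST FRAMING.  NECESSARY-CONDITION readings on the tree's own rows and objects (count-neutral, LOCATED): nothing of Bałaban asserted or refuted; K1⁹'s `∃θ` NOT refuted; N11 NOT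
discharged; K1⁹ NOT closed; no registered stub touched; counts unmoved (typed 28∕28 · discharged 5∕27 · A 5∕28); NOT ℝ⁴ ∕ OS ∕ mass gap ∕ Clay.  No `sorry`, `axiom`, `def`, `instance`,
`notation`.  Sources (SHAPE only): [III] Thm 1 p.262, Thm 2 p.263, §3 p.279, (3.1)–(3.5) pp.264–265, (3.25) p.270, p.267; [B7] Prop. 2 (52)–(54) p.26; [I] Thm 1 p.259.
-/

noncomputable section

open MeasureTheory
open scoped BigOperators Matrix.Norms.L2Operator

namespace Summit.QuantumFields.YangMills.Theorems.BalabanUVNodesN11TopPairLocalResidualChain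

open Literature.MathematicalPhysics.QuantumFieldTheory.Balaban1983to89 T4Continuum Node00 Node00.Tk B14.Eq218Concrete B14.Sect3Decomp
open Literature.MathematicalPhysics.QuantumFieldTheory.Balaban1983to89.ExpMeanLog (deltaSU)
open B14.Eq213MaximalDomains (side)
open BalabanUVNodesN11SupplyChainFirstLink (FirstStepClausesAt)
open BalabanUVNodesN11Sect3SupplySpliceOwnBoundary (graftAboveB)
open BalabanUVNodesN11Sect3SupplyChainDefs (Sect3Supplier PresentChildObligations)
open BalabanUVNodesN11Sect3SupplyChainObligationsDefs (ChainFormTAt tLaw₁₃CoPH_of_chainFormTAt)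
open BalabanUVNodesN11TopPairLocalResidual (main_term_absent_of_O3_of_provisos₁₃SepCoPH_su2 main_term_absent_of_O3_of_provisos₁₃CoPH_su2
  tLaw₁₃CoPH_zero_top_pair_degenerate_of_lt_dist1)
open Summit.QuantumFields.YangMills.BalabanUVNodes.N07Thm1ScaledInterfaceInstance (su2_dist1_surj)

variable {F : T4Family} (θ : Stage13HParams F 2) (p : B12.RunParams)

/-- (v1.1, T0′ of the FLAG №1 R2b cure: the DISPLAYED one-scale law `hzh` of the step-1 residuals replaces the proviso structure, whose row `zhLocal` the cure re-types to print's two-scale law.) ★★★★ **dag-n08-w2's PER-PAIR MATRIX AT THE TOP PAIR IS MET ONLY DEGENERATELY**: for every `θ : Stage13HParams F 2` whose step-1 residuals obey `hzh` (no proviso read), under the numerics guards, at a history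
`s′ = (𝕋, 𝕋)` and any `(u₁, e₁)`, `FirstStepClausesAt θ p s′ u₁ e₁` ⇒ the 𝐓-slot `𝐓ρ₀(s′)` is the zero function or vanishes a.e. on `{χ₁(s′) ≠ 0}` (its clause (iii) is the test's
hypothesis). [cite: Balaban1988Convergent, Thm 1 p.262, (3.1)–(3.5) pp.264–265, (3.25) p.270, p.267; Balaban1985Averaging, Prop. 2 (52)–(54) p.26; Balaban1987RG1, Thm 1 p.259] -/
theorem firstStepClausesAt_top_pair_degenerate_su2 (hzh : ∀ (Ω Λ : ℕ → Set (Site (F.P p.K) 0)) Y ω ω', ω 0 = ω' 0 → (θ.Zh p 1 Ω Λ).ζ0 0 Y ω = (θ.Zh p 1 Ω Λ).ζ0 0 Y ω') (hM : 1 ≤ θ.τ9.M) (hM₂ : 0 < θ.ν.M₂) (hK : 0 < p.K) {α₀ : ℝ} (hα : 0 < α₀)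
    (hα3 : (143 * (((((F.P p.K).d + 4 : ℕ) : ℝ)) ^ 2 / 4) ^ 2) * α₀ ≤ 1 / 3)
    (hα2 : 2 * α₀ ≤ 2 * deltaSU (Fin 2) / ((((F.P p.K).d + 4) * (F.P p.K).L : ℕ) : ℝ) ^ 2)
    (hαε : epsOfRecord θ.ν (gOfRecord₁₃ F 2 θ.toStage13Params p) 1 * (F.P p.K).eta 1 ^ 2 + 4 * (2 * deltaOfRecord θ.ν (gOfRecord₁₃ F 2 θ.toStage13Params p) 0 θ.A₁) ≤
      α₀ * (F.P p.K).eta 1 ^ 2)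
    (hαr : 2 * α₀ * (((F.P p.K).L : ℝ) ^ 1 * (F.P p.K).eta 1) ^ 2 ≤ 2 * θ.ν.εreg)
    (hε₁ : 0 < epsOfRecord θ.ν (gOfRecord₁₃ F 2 θ.toStage13Params p) 1 * (F.P p.K).eta 1 ^ 2) (hmK : 1 ≤ (F.P p.K).m + (F.P p.K).K) (hε : 0 < θ.ν.εreg)
    (hε3 : (143 * (((((F.P p.K).d + 4 : ℕ) : ℝ)) ^ 2 / 4) ^ 2) * θ.ν.εreg ≤ 1 / 3)
    (hε2 : 2 * θ.ν.εreg ≤ 2 * deltaSU (Fin 2) / ((((F.P p.K).d + 4) * (F.P p.K).L : ℕ) : ℝ) ^ 2)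
    (hM1 : 1 ≤ θ.ν.M₁) (h3 : 3 * side (F.P p.K).L θ.ν.M₁ 1 ≤ sideχ F θ.ν p (gOfRecord₁₃ F 2 θ.toStage13Params p) 0)
    (s' : SeqOfRecord F θ.ν θ.τ9.M (gOfRecord₁₃ F 2 θ.toStage13Params p) p.K 1) (hΩ : s'.Ω 1 = Set.univ) (hΛ : s'.Λ 1 = Set.univ)
    (u₁ : Sect2.TermValues (F.P p.K) (MatA 2) (FluctV 2) θ.τ9.M) (e₁ : ℝ) (hfs : FirstStepClausesAt θ p s' u₁ e₁) :
    slotsTOfRecord F 2 θ.ν θ.τ9 (EOfRecord₁₃ F 2 θ.toStage13Params) (wOfRecord₉ F 2 θ.toStage9Params) θ.ppSel p (gOfRecord₁₃ F 2 θ.toStage13Params p) 1 s' = 0 ∨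
      ∀ᵐ V' ∂fieldMeasure (F.P p.K) 1 (SU 2),
        chiSeqOfRecord F 2 θ.ν θ.τ9.M (gOfRecord₁₃ F 2 θ.toStage13Params p) p.K 1 s' V' ≠ 0 →
          slotsTOfRecord F 2 θ.ν θ.τ9 (EOfRecord₁₃ F 2 θ.toStage13Params) (wOfRecord₉ F 2 θ.toStage9Params) θ.ppSel p (gOfRecord₁₃ F 2 θ.toStage13Params p) 1 s' V' = 0 :=
  main_term_absent_of_O3_of_provisos₁₃SepCoPH_su2 θ p hzh hM hM₂ hK hα hα3 hα2 hαε hαr hε₁ hmK hε hε3 hε2 hM1 h3 s' hΩ hΛ u₁ e₁ hfs.2.2.2.2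

/-- (v1.1, T0′ of the FLAG №1 R2b cure: the DISPLAYED one-scale law `hzh` of the step-1 residuals replaces the proviso structure, whose row `zhLocal` the cure re-types to print's two-scale law.) ★★★★ **dag-n11-e's `PresentChildObligations` AT `k = 0` SERVE THE TOP CHILD ONLY DEGENERATELY**: for every `θ : Stage13HParams F 2` whose step-1 residuals obey `hzh` (no proviso read), under the numerics guards,
at a history `s′ = (𝕋, 𝕋)` and any term families `(t, tnew, E)`, `PresentChildObligations θ p 0 t tnew E s′` ⇒ the 𝐓-slot `𝐓ρ₀(s′)` is the zero function or vanishes a.e. on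
`{χ₁(s′) ≠ 0}` (its clause (O3′), with the spliced terms `graftAboveB 0 (t (init s′)) (tnew s′)`, is the test's hypothesis). [cite: Balaban1988Convergent, Thm 1 p.262, Thm 2 p.263, §3 p.279, (3.1)–(3.5) pp.264–265, (3.25) p.270; Balaban1985Averaging, Prop. 2 (52)–(54) p.26] -/
theorem presentChildObligations_zero_top_pair_degenerate_su2 (hzh : ∀ (Ω Λ : ℕ → Set (Site (F.P p.K) 0)) Y ω ω', ω 0 = ω' 0 → (θ.Zh p 1 Ω Λ).ζ0 0 Y ω = (θ.Zh p 1 Ω Λ).ζ0 0 Y ω') (hM : 1 ≤ θ.τ9.M) (hM₂ : 0 < θ.ν.M₂) (hK : 0 < p.K) {α₀ : ℝ} (hα : 0 < α₀)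
    (hα3 : (143 * (((((F.P p.K).d + 4 : ℕ) : ℝ)) ^ 2 / 4) ^ 2) * α₀ ≤ 1 / 3)
    (hα2 : 2 * α₀ ≤ 2 * deltaSU (Fin 2) / ((((F.P p.K).d + 4) * (F.P p.K).L : ℕ) : ℝ) ^ 2)
    (hαε : epsOfRecord θ.ν (gOfRecord₁₃ F 2 θ.toStage13Params p) 1 * (F.P p.K).eta 1 ^ 2 + 4 * (2 * deltaOfRecord θ.ν (gOfRecord₁₃ F 2 θ.toStage13Params p) 0 θ.A₁) ≤
      α₀ * (F.P p.K).eta 1 ^ 2)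
    (hαr : 2 * α₀ * (((F.P p.K).L : ℝ) ^ 1 * (F.P p.K).eta 1) ^ 2 ≤ 2 * θ.ν.εreg)
    (hε₁ : 0 < epsOfRecord θ.ν (gOfRecord₁₃ F 2 θ.toStage13Params p) 1 * (F.P p.K).eta 1 ^ 2) (hmK : 1 ≤ (F.P p.K).m + (F.P p.K).K) (hε : 0 < θ.ν.εreg)
    (hε3 : (143 * (((((F.P p.K).d + 4 : ℕ) : ℝ)) ^ 2 / 4) ^ 2) * θ.ν.εreg ≤ 1 / 3)
    (hε2 : 2 * θ.ν.εreg ≤ 2 * deltaSU (Fin 2) / ((((F.P p.K).d + 4) * (F.P p.K).L : ℕ) : ℝ) ^ 2)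
    (hM1 : 1 ≤ θ.ν.M₁) (h3 : 3 * side (F.P p.K).L θ.ν.M₁ 1 ≤ sideχ F θ.ν p (gOfRecord₁₃ F 2 θ.toStage13Params p) 0)
    (t : SeqOfRecord F θ.ν θ.τ9.M (gOfRecord₁₃ F 2 θ.toStage13Params p) p.K 0 → Sect2.TermValues (F.P p.K) (MatA 2) (FluctV 2) θ.τ9.M)
    (tnew : SeqOfRecord F θ.ν θ.τ9.M (gOfRecord₁₃ F 2 θ.toStage13Params p) p.K 1 → Sect2.TermValues (F.P p.K) (MatA 2) (FluctV 2) θ.τ9.M)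
    (EkN : SeqOfRecord F θ.ν θ.τ9.M (gOfRecord₁₃ F 2 θ.toStage13Params p) p.K 1 → ℝ)
    (s' : SeqOfRecord F θ.ν θ.τ9.M (gOfRecord₁₃ F 2 θ.toStage13Params p) p.K 1) (hΩ : s'.Ω 1 = Set.univ) (hΛ : s'.Λ 1 = Set.univ)
    (hpc : PresentChildObligations θ p 0 t tnew EkN s') :
    slotsTOfRecord F 2 θ.ν θ.τ9 (EOfRecord₁₃ F 2 θ.toStage13Params) (wOfRecord₉ F 2 θ.toStage9Params) θ.ppSel p (gOfRecord₁₃ F 2 θ.toStage13Params p) 1 s' = 0 ∨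
      ∀ᵐ V' ∂fieldMeasure (F.P p.K) 1 (SU 2),
        chiSeqOfRecord F 2 θ.ν θ.τ9.M (gOfRecord₁₃ F 2 θ.toStage13Params p) p.K 1 s' V' ≠ 0 →
          slotsTOfRecord F 2 θ.ν θ.τ9 (EOfRecord₁₃ F 2 θ.toStage13Params) (wOfRecord₉ F 2 θ.toStage9Params) θ.ppSel p (gOfRecord₁₃ F 2 θ.toStage13Params p) 1 s' V' = 0 :=
  main_term_absent_of_O3_of_provisos₁₃SepCoPH_su2 θ p hzh hM hM₂ hK hα hα3 hα2 hαε hαr hε₁ hmK hε hε3 hε2 hM1 h3 s' hΩ hΛ (graftAboveB 0 (t s'.init) (tnew s')) (EkN s')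
    hpc.2.2.2.2.2

/-- (v1.1, T0′ of the FLAG №1 R2b cure: the DISPLAYED one-scale law `hzh` of the step-1 residuals replaces the proviso structure, whose row `zhLocal` the cure re-types to print's two-scale law.) ★★★★★ **THE CHAIN's FIRST 𝐓-FORM SERVES EVERY TOP PAIR ONLY DEGENERATELY**: for every `θ : Stage13HParams F 2` whose step-1 residuals obey `hzh` (no proviso read), under the numerics guards, every
supplier `σ` with `ChainFormTAt θ p σ 0` (the first 𝐓-law for the supplier's own spliced witness — `tLaw₁₃CoPH_of_chainFormTAt`) has, at every history `s′ = (𝕋, 𝕋)`, a 𝐓-slot that is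
the zero function or vanishes a.e. on `{χ₁(s′) ≠ 0}`. [cite: Balaban1988Convergent, Thm 1 p.262, Thm 2 p.263, remark p.262, §3 p.279, (3.1)–(3.5) pp.264–265, (3.25) p.270, p.267; Balaban1985Averaging, Prop. 2 (52)–(54) p.26; Balaban1987RG1, Thm 1 p.259] -/
theorem chainFormTAt_zero_top_pair_degenerate_su2 (hzh : ∀ (Ω Λ : ℕ → Set (Site (F.P p.K) 0)) Y ω ω', ω 0 = ω' 0 → (θ.Zh p 1 Ω Λ).ζ0 0 Y ω = (θ.Zh p 1 Ω Λ).ζ0 0 Y ω') (hM : 1 ≤ θ.τ9.M) (hM₂ : 0 < θ.ν.M₂) (hK : 0 < p.K) {α₀ : ℝ} (hα : 0 < α₀)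
    (hα3 : (143 * (((((F.P p.K).d + 4 : ℕ) : ℝ)) ^ 2 / 4) ^ 2) * α₀ ≤ 1 / 3)
    (hα2 : 2 * α₀ ≤ 2 * deltaSU (Fin 2) / ((((F.P p.K).d + 4) * (F.P p.K).L : ℕ) : ℝ) ^ 2)
    (hαε : epsOfRecord θ.ν (gOfRecord₁₃ F 2 θ.toStage13Params p) 1 * (F.P p.K).eta 1 ^ 2 + 4 * (2 * deltaOfRecord θ.ν (gOfRecord₁₃ F 2 θ.toStage13Params p) 0 θ.A₁) ≤
      α₀ * (F.P p.K).eta 1 ^ 2)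
    (hαr : 2 * α₀ * (((F.P p.K).L : ℝ) ^ 1 * (F.P p.K).eta 1) ^ 2 ≤ 2 * θ.ν.εreg)
    (hε₁ : 0 < epsOfRecord θ.ν (gOfRecord₁₃ F 2 θ.toStage13Params p) 1 * (F.P p.K).eta 1 ^ 2) (hmK : 1 ≤ (F.P p.K).m + (F.P p.K).K) (hε : 0 < θ.ν.εreg)
    (hε3 : (143 * (((((F.P p.K).d + 4 : ℕ) : ℝ)) ^ 2 / 4) ^ 2) * θ.ν.εreg ≤ 1 / 3)
    (hε2 : 2 * θ.ν.εreg ≤ 2 * deltaSU (Fin 2) / ((((F.P p.K).d + 4) * (F.P p.K).L : ℕ) : ℝ) ^ 2)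
    (hM1 : 1 ≤ θ.ν.M₁) (h3 : 3 * side (F.P p.K).L θ.ν.M₁ 1 ≤ sideχ F θ.ν p (gOfRecord₁₃ F 2 θ.toStage13Params p) 0)
    (σ : Sect3Supplier θ p) (hform : ChainFormTAt θ p σ 0)
    (s' : SeqOfRecord F θ.ν θ.τ9.M (gOfRecord₁₃ F 2 θ.toStage13Params p) p.K 1) (hΩ : s'.Ω 1 = Set.univ) (hΛ : s'.Λ 1 = Set.univ) :
    slotsTOfRecord F 2 θ.ν θ.τ9 (EOfRecord₁₃ F 2 θ.toStage13Params) (wOfRecord₉ F 2 θ.toStage9Params) θ.ppSel p (gOfRecord₁₃ F 2 θ.toStage13Params p) 1 s' = 0 ∨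
      ∀ᵐ V' ∂fieldMeasure (F.P p.K) 1 (SU 2),
        chiSeqOfRecord F 2 θ.ν θ.τ9.M (gOfRecord₁₃ F 2 θ.toStage13Params p) p.K 1 s' V' ≠ 0 →
          slotsTOfRecord F 2 θ.ν θ.τ9 (EOfRecord₁₃ F 2 θ.toStage13Params) (wOfRecord₉ F 2 θ.toStage9Params) θ.ppSel p (gOfRecord₁₃ F 2 θ.toStage13Params p) 1 s' V' = 0 := by
  obtain ⟨g₀, hg₀⟩ := su2_dist1_surj 2 zero_le_two le_rfl
  have hd : (F.P p.K).d = 4 := rfl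
  have hεlt : 2 * θ.ν.εreg < dist1 g₀ := by
    rw [hg₀]
    rw [hd] at hε3
    norm_num at hε3
    linarith
  exact tLaw₁₃CoPH_zero_top_pair_degenerate_of_lt_dist1 θ p hM hM₂ hK hα hα3 hα2 hαε hαr hε₁ hmK hε hε3 hε2 hM1 h3 g₀ hεlt (tLaw₁₃CoPH_of_chainFormTAt hform) s'
    (hzh s'.Ω s'.Λ) hΩ hΛ

end Summit.QuantumFields.YangMills.Theorems.BalabanUVNodesN11TopPairLocalResidualChain

end
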